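import Summits.AtomisticToContinuum.HydrodynamicLimit.Theorems.CollisionIsometryCLTMacroClosureStubBlockMGFKinetic
import Literature.Analysis.FunctionSpaces.BochnerProofs
import HarnessLib

/-!
# Stub `stub_blockMGF` of the line `IdeatorTwoGen1Sketch` (crux `MacroClosure`, stmt-14870), part 4:
# the exact joint Laplace transform of block temperature and block drift (Cochran without rotations;
# registered sub-goal `stub_blockMGF_cochran`)

Proof file (`--supports stmt-AtomisticToContinuum-14870`) for the registered sub-goal
`stub_blockMGF_cochran` of `Barycentric.stub_blockMGF : HomogeneousBlockMGF`. For a block of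
`n + 1` particles with unit weights (the box blocks of the lossless convexity reduction) and i.i.d.
velocities `N(u, θ id)` — the velocity marginal of the homogeneous local Gibbs law given the
positions — the sum of squares about the mean `SS = Σ‖vᵢ‖² − ‖Σvᵢ‖²/(n+1) = 3(n+1)θ̄·` and the drift
`(n+1)‖v̄ − u‖² = ‖Σvᵢ − (n+1)u‖²/(n+1)` have the EXACT joint Laplace transform

`E exp(−(λ/θ) SS − (κ/θ)(n+1)‖v̄ − u‖²) = (1 + 2λ)^{−(3/2)n} (1 + 2κ)^{−3/2}`, `2λ > −1`, `2κ > −1`,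

i.e. that of `θχ²_{3n} ⊗ θχ²_3` (Cochran's theorem for the empirical variance, both tails, jointly
with the drift) — proved WITHOUT rotation invariance: the family of exponentials of
`−(λ/θ)SS_m − (κ/θ)m‖v̄_m − u‖²` is closed under integrating out the last particle against
`N(u, θ id)` (`κ ↦ κ' = (λ + κm + 2λκ(m+1))/(m + 1 + 2λm + 2κ)`, with
`(1 + 2κ')(1 + 2(λm + κ)/(m+1)) = (1 + 2λ)(1 + 2κ)`), by the exact one-particle quadratic–linear
Gaussian integral `lintegral_exp_quad_gaussMeasure` (Mathlib's
`GaussianFourier.integral_cexp_neg_mul_sq_norm_add` in real `lintegral` form) and Tonelli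
(`lintegral_pi_succ_cons`, part 2). This is the complete single-block velocity statistics of
`HomogeneousBlockMGF` at the reference drift `u = u_c`: hot blocks (`λ < 0`), cold blocks (`λ > 0`),
and the drift term `ρ̄‖ū − u_c‖²/(2θ_c)` (`κ < 0`) of the kinetic Bregman divergence, jointly and with
the sharp constants.
-/

noncomputable section

open MeasureTheory Filter Set Topology InformationTheory ProbabilityTheory
open scoped ENNReal ContDiff InnerProductSpace

namespace Summit.AtomisticToContinuum.HydrodynamicLimit.Theorems.MacroClosureLine

open Literature.MathematicalPhysics.KineticTheory Literature.Analysis.FluidPDE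
open Literature.Analysis.FunctionSpaces

namespace Barycentric

/-! ## The one-particle quadratic–linear Gaussian integral -/

/-- The Gaussian weight with a linear term is integrable on `ℝ³` (`B > 0`). [folklore] -/
theorem integrable_exp_neg_mul_sq_norm_add_inner {B : ℝ} (hB : 0 < B) (w₀ : V3) :
    Integrable (fun w : V3 => Real.exp (-B * ‖w‖ ^ 2 + 1 * inner ℝ w₀ w)) := by
  have h := (GaussianFourier.integrable_cexp_neg_mul_sq_norm_add (V := V3) (b := (B : ℂ))
    (by simpa using hB) (1 : ℂ) w₀).norm
  refine h.congr (ae_of_all _ fun w => ?_)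
  have h1 : (-(B : ℂ) * (‖w‖ : ℂ) ^ 2 + (1 : ℂ) * (inner ℝ w₀ w : ℂ)) =
      ((-B * ‖w‖ ^ 2 + 1 * inner ℝ w₀ w : ℝ) : ℂ) := by
    push_cast
    ring
  simp only [h1, Complex.norm_exp, Complex.ofReal_re]

/-- The real Gaussian integral with a linear term on `ℝ³`, in `lintegral` form:
`∫⁻ exp(−B‖w‖² + ⟪w₀, w⟫) dw = (π/B)^{3/2} exp(‖w₀‖²/(4B))` (`B > 0`). [folklore] -/
theorem lintegral_exp_neg_mul_sq_norm_add_inner {B : ℝ} (hB : 0 < B) (w₀ : V3) :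
    ∫⁻ w : V3, ENNReal.ofReal (Real.exp (-B * ‖w‖ ^ 2 + 1 * inner ℝ w₀ w)) =
      ENNReal.ofReal ((Real.pi / B) ^ ((3 : ℝ) / 2) * Real.exp (‖w₀‖ ^ 2 / (4 * B))) := by
  rw [← ofReal_integral_eq_lintegral_ofReal (integrable_exp_neg_mul_sq_norm_add_inner hB w₀)
    (ae_of_all _ fun w => (Real.exp_pos _).le), integral_rexp_neg_mul_sq_norm_add hB 1 w₀]
  congr 1
  simp

/-- **One-particle quadratic–linear Gaussian integral** (exact, `lintegral` form): for `θ > 0`,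
`2Aθ > −1`, `b ∈ ℝ³`, `c ∈ ℝ`,
`∫⁻ exp(−A‖x‖² + ⟪b, x⟫ + c) N(u, θ id)(dx)
   = (1 + 2Aθ)^{−3/2} exp(⟪b, u⟫ − A‖u‖² + c + θ‖b − 2Au‖²/(2(1 + 2Aθ)))`. [folklore] -/
theorem lintegral_exp_quad_gaussMeasure (u b : V3) (c : ℝ) {θ A : ℝ} (hθ : 0 < θ)
    (hA : -1 < 2 * A * θ) :
    ∫⁻ x, ENNReal.ofReal (Real.exp (-A * ‖x‖ ^ 2 + inner ℝ b x + c)) ∂(gaussMeasure u θ) =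
      ENNReal.ofReal ((1 + 2 * A * θ) ^ (-(3 : ℝ) / 2) *
        Real.exp (inner ℝ b u - A * ‖u‖ ^ 2 + c +
          θ * ‖b - (2 * A) • u‖ ^ 2 / (2 * (1 + 2 * A * θ)))) := by
  have hsq : 0 < Real.sqrt θ := Real.sqrt_pos.2 hθ
  set B : ℝ := 1 / 2 + A * θ with hB_def
  have hB : 0 < B := by rw [hB_def]; linarith
  set w₀ : V3 := Real.sqrt θ • (b - (2 * A) • u) with hw₀_def
  set K : ℝ := (2 * Real.pi) ^ (-(3 : ℝ) / 2) * Real.exp (inner ℝ b u - A * ‖u‖ ^ 2 + c) with hK_def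
  have hK0 : 0 ≤ K := mul_nonneg (Real.rpow_nonneg (by positivity) _) (Real.exp_pos _).le
  -- to the standard Gaussian, then to Lebesgue measure with the Maxwellian density
  rw [gaussMeasure, ← coe_gaussShiftEquiv u hθ, lintegral_map_equiv,
    show stdGaussian V3 = _ from stdGaussian_eq_withDensity_globalMaxwellian_holds,
    lintegral_withDensity_eq_lintegral_mul₀
      (continuous_globalMaxwellian.measurable.ennreal_ofReal.aemeasurable)
      (Measurable.aemeasurable (by
        refine ENNReal.measurable_ofReal.comp (Continuous.measurable ?_)
        simp only [coe_gaussShiftEquiv]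
        fun_prop))]
  -- pointwise: complete the linear–quadratic form in the new variable
  have hpt : ∀ w : V3, ENNReal.ofReal (globalMaxwellian w) *
      ENNReal.ofReal (Real.exp (-A * ‖u + Real.sqrt θ • w‖ ^ 2 +
        inner ℝ b (u + Real.sqrt θ • w) + c)) =
      ENNReal.ofReal K * ENNReal.ofReal (Real.exp (-B * ‖w‖ ^ 2 + 1 * inner ℝ w₀ w)) := by
    intro w
    rw [← ENNReal.ofReal_mul (globalMaxwellian_pos w).le, ← ENNReal.ofReal_mul hK0,
      globalMaxwellian_V3, hK_def, mul_assoc, mul_assoc, ← Real.exp_add, ← Real.exp_add]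
    congr 3
    rw [hB_def, hw₀_def, norm_add_sq_real, inner_add_right, inner_smul_right, inner_smul_right,
      norm_smul, mul_pow, Real.norm_eq_abs, sq_abs, Real.sq_sqrt hθ.le, real_inner_smul_left,
      inner_sub_left, real_inner_smul_left]
    ring
  simp only [Pi.mul_apply, coe_gaussShiftEquiv]
  simp_rw [hpt]
  rw [lintegral_const_mul' _ _ ENNReal.ofReal_ne_top, lintegral_exp_neg_mul_sq_norm_add_inner hB,
    ← ENNReal.ofReal_mul hK0]
  congr 1
  -- constants
  have hnorm : ‖w₀‖ ^ 2 = θ * ‖b - (2 * A) • u‖ ^ 2 := by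
    rw [hw₀_def, norm_smul, mul_pow, Real.norm_eq_abs, sq_abs, Real.sq_sqrt hθ.le]
  have h4B : 4 * B = 2 * (1 + 2 * A * θ) := by rw [hB_def]; ring
  have h2B : 2 * B = 1 + 2 * A * θ := by rw [hB_def]; ring
  rw [hK_def, hnorm, h4B, mul_mul_mul_comm, gauss_const_mul hB, h2B, mul_assoc, ← Real.exp_add]

/-! ## The Helmert–Cochran recursion -/

/-- **One Helmert step, exactly** (unit weights): splitting off the new particle `x` from a block
of `m` particles with kinetic sum `S₂` and momentum `M`, the tilted exponent is quadratic–linear in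
`x`: `−(λ/θ)(‖x‖² + S₂ − ‖x + M‖²/(m+1)) − (κ/(θ(m+1)))‖x + M − (m+1)u‖² = −A‖x‖² + ⟪B, x⟫ + C`
with `A = (λm + κ)/(θ(m+1))`, `B = (2/(θ(m+1)))((λ − κ)M + κ(m+1)u)`,
`C = −(λ/θ)(S₂ − ‖M‖²/(m+1)) − (κ/(θ(m+1)))‖M − (m+1)u‖²`. [folklore] -/
theorem helmert_exact_split {θ m l κ S₂ : ℝ} (hθ : θ ≠ 0) (hm : m + 1 ≠ 0) (x M u : V3) :
    -(l / θ) * (‖x‖ ^ 2 + S₂ - ‖x + M‖ ^ 2 / (m + 1)) -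
        κ / (θ * (m + 1)) * ‖x + M - (m + 1) • u‖ ^ 2 =
      -((l * m + κ) / (θ * (m + 1))) * ‖x‖ ^ 2 +
        inner ℝ ((2 / (θ * (m + 1))) • ((l - κ) • M + (κ * (m + 1)) • u)) x +
        (-(l / θ) * (S₂ - ‖M‖ ^ 2 / (m + 1)) - κ / (θ * (m + 1)) * ‖M - (m + 1) • u‖ ^ 2) := by
  rw [show x + M - (m + 1) • u = x + (M - (m + 1) • u) by abel, norm_add_sq_real, norm_add_sq_real,
    norm_sub_sq_real, real_inner_smul_left, inner_add_left, real_inner_smul_left,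
    real_inner_smul_left, inner_sub_right, inner_smul_right, inner_smul_right, norm_smul,
    mul_pow, Real.norm_eq_abs, sq_abs, real_inner_comm M x, real_inner_comm u x]
  field_simp
  ring

/-- **The recursion closes**: after the Gaussian integration of the new particle the exponent is
again of the form `−(λ/θ)SS_m − (κ'/(θm))‖M − mu‖²` with
`κ' = (λ + κm + 2λκ(m+1))/(m + 1 + 2λm + 2κ)`. [folklore] -/
theorem helmert_exact_close {θ m l κ S₂ : ℝ} (hθ : θ ≠ 0) (hm0 : m ≠ 0) (hm : m + 1 ≠ 0)
    (hD : m + 1 + 2 * l * m + 2 * κ ≠ 0) (M u : V3) :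
    let A : ℝ := (l * m + κ) / (θ * (m + 1))
    let B : V3 := (2 / (θ * (m + 1))) • ((l - κ) • M + (κ * (m + 1)) • u)
    let C : ℝ := -(l / θ) * (S₂ - ‖M‖ ^ 2 / (m + 1)) - κ / (θ * (m + 1)) * ‖M - (m + 1) • u‖ ^ 2
    inner ℝ B u - A * ‖u‖ ^ 2 + C + θ * ‖B - (2 * A) • u‖ ^ 2 / (2 * (1 + 2 * A * θ)) =
      -(l / θ) * (S₂ - ‖M‖ ^ 2 / m) -
        (l + κ * m + 2 * l * κ * (m + 1)) / (m + 1 + 2 * l * m + 2 * κ) / (θ * m) *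
          ‖M - m • u‖ ^ 2 := by
  dsimp only
  have hA : 1 + 2 * ((l * m + κ) / (θ * (m + 1))) * θ = (m + 1 + 2 * l * m + 2 * κ) / (m + 1) := by
    field_simp
    ring
  rw [hA]
  simp only [norm_sub_sq_real, norm_add_sq_real, inner_add_left, real_inner_smul_left,
    inner_smul_right, norm_smul, mul_pow, Real.norm_eq_abs, sq_abs, real_inner_self_eq_norm_sq]
  -- clear denominators with the recursion denominator as an atom, then substitute it back
  generalize hd : m + 1 + 2 * l * m + 2 * κ = d at *
  field_simp
  rw [← hd]
  ring

/-- The product identity of the recursion: `(1 + 2(λm + κ)/(m+1)) (1 + 2κ') = (1 + 2λ)(1 + 2κ)`.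
[folklore] -/
theorem helmert_exact_product {m l κ : ℝ} (hm : m + 1 ≠ 0) (hD : m + 1 + 2 * l * m + 2 * κ ≠ 0) :
    (1 + 2 * ((l * m + κ) / (m + 1))) *
        (1 + 2 * ((l + κ * m + 2 * l * κ * (m + 1)) / (m + 1 + 2 * l * m + 2 * κ))) =
      (1 + 2 * l) * (1 + 2 * κ) := by
  field_simp
  ring

/-- **Exact joint Laplace transform of the empirical variance and the drift** (Cochran's theorem
for `n + 1` i.i.d. `N(u, θ id)` vectors in `ℝ³`, without rotation invariance): for `θ > 0`,
`2λ > −1`, `2κ > −1`,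
`E exp(−(λ/θ)(Σ‖vᵢ‖² − ‖Σvᵢ‖²/(n+1)) − (κ/(θ(n+1)))‖Σvᵢ − (n+1)u‖²) = (1+2λ)^{−(3/2)n}(1+2κ)^{−3/2}`.
Induction on `n`: the new particle is integrated first (`lintegral_pi_succ_cons`,
`lintegral_exp_quad_gaussMeasure`) and the recursion closes (`helmert_exact_close`). [folklore] -/
theorem lintegral_exp_cochran (u : V3) {θ : ℝ} (hθ : 0 < θ) {l : ℝ} (hl : -1 < 2 * l) :
    ∀ (n : ℕ) (κ : ℝ), -1 < 2 * κ →
      ∫⁻ v, ENNReal.ofReal (Real.exp (-(l / θ) * ((∑ i, ‖v i‖ ^ 2) - ‖∑ i, v i‖ ^ 2 / ((n : ℝ) + 1)) -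
          κ / (θ * ((n : ℝ) + 1)) * ‖(∑ i, v i) - ((n : ℝ) + 1) • u‖ ^ 2))
        ∂(Measure.pi fun _ : Fin (n + 1) => gaussMeasure u θ) =
      ENNReal.ofReal ((1 + 2 * l) ^ (-(3 : ℝ) / 2 * n) * (1 + 2 * κ) ^ (-(3 : ℝ) / 2)) := by
  intro n
  induction n with
  | zero =>
    intro κ hκ
    -- one particle: `SS = 0`, drift `‖v₀ − u‖²`
    have hF : Measurable fun v : Fin (0 + 1) → V3 => ENNReal.ofReal (Real.exp
        (-(l / θ) * ((∑ i, ‖v i‖ ^ 2) - ‖∑ i, v i‖ ^ 2 / (((0 : ℕ) : ℝ) + 1)) -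
          κ / (θ * (((0 : ℕ) : ℝ) + 1)) * ‖(∑ i, v i) - (((0 : ℕ) : ℝ) + 1) • u‖ ^ 2)) := by
      refine ENNReal.measurable_ofReal.comp (Continuous.measurable ?_)
      fun_prop
    rw [lintegral_pi_succ_cons hF]
    have hinner : ∀ y : Fin 0 → V3, ∫⁻ x, ENNReal.ofReal (Real.exp
        (-(l / θ) * ((∑ i, ‖(Fin.cons x y : Fin (0 + 1) → V3) i‖ ^ 2) -
            ‖∑ i, (Fin.cons x y : Fin (0 + 1) → V3) i‖ ^ 2 / (((0 : ℕ) : ℝ) + 1)) -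
          κ / (θ * (((0 : ℕ) : ℝ) + 1)) *
            ‖(∑ i, (Fin.cons x y : Fin (0 + 1) → V3) i) - (((0 : ℕ) : ℝ) + 1) • u‖ ^ 2))
          ∂(gaussMeasure u θ) = ENNReal.ofReal ((1 + 2 * κ) ^ (-(3 : ℝ) / 2)) := by
      intro y
      have hpt : ∀ x : V3, -(l / θ) * ((∑ i, ‖(Fin.cons x y : Fin (0 + 1) → V3) i‖ ^ 2) -
            ‖∑ i, (Fin.cons x y : Fin (0 + 1) → V3) i‖ ^ 2 / (((0 : ℕ) : ℝ) + 1)) -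
          κ / (θ * (((0 : ℕ) : ℝ) + 1)) *
            ‖(∑ i, (Fin.cons x y : Fin (0 + 1) → V3) i) - (((0 : ℕ) : ℝ) + 1) • u‖ ^ 2 =
          -(κ / θ) * ‖x‖ ^ 2 + inner ℝ ((2 * (κ / θ)) • u) x + (-(κ / θ) * ‖u‖ ^ 2) := by
        intro x
        simp only [Fin.sum_univ_succ, Fin.cons_zero, Finset.univ_eq_empty, Finset.sum_empty,
          add_zero, Nat.cast_zero, zero_add, div_one, one_smul, mul_one, sub_self, mul_zero, zero_sub]
        rw [norm_sub_sq_real, real_inner_smul_left, real_inner_comm x u]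
        ring
      simp_rw [hpt]
      have hκθ : -1 < 2 * (κ / θ) * θ := by
        have e : 2 * (κ / θ) * θ = 2 * κ := by field_simp
        rw [e]
        exact hκ
      rw [lintegral_exp_quad_gaussMeasure u _ _ hθ hκθ]
      congr 1
      have h1 : 1 + 2 * (κ / θ) * θ = 1 + 2 * κ := by field_simp
      rw [h1]
      have h2 : inner ℝ ((2 * (κ / θ)) • u) u - κ / θ * ‖u‖ ^ 2 + -(κ / θ) * ‖u‖ ^ 2 +
          θ * ‖(2 * (κ / θ)) • u - (2 * (κ / θ)) • u‖ ^ 2 / (2 * (1 + 2 * κ)) = 0 := by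
        rw [sub_self, norm_zero, real_inner_smul_left, real_inner_self_eq_norm_sq]
        ring
      rw [h2, Real.exp_zero, mul_one]
    simp_rw [hinner]
    rw [lintegral_const, measure_univ, mul_one]
    congr 1
    simp
  | succ n ih =>
    intro κ hκ
    -- `m = n + 1` old particles, one new particle
    set m : ℝ := (n : ℝ) + 1 with hm_def
    have hm0 : 0 < m := by rw [hm_def]; positivity
    have hm1 : (((n + 1 : ℕ) : ℝ) + 1) = m + 1 := by rw [hm_def]; push_cast; ring
    have hD : 0 < m + 1 + 2 * l * m + 2 * κ := by nlinarith
    set A : ℝ := (l * m + κ) / (θ * (m + 1)) with hA_def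
    have hAθ : 1 + 2 * A * θ = (m + 1 + 2 * l * m + 2 * κ) / (m + 1) := by
      rw [hA_def]
      field_simp
      ring
    have hA : -1 < 2 * A * θ := by
      have : 0 < 1 + 2 * A * θ := by rw [hAθ]; positivity
      linarith
    set κ' : ℝ := (l + κ * m + 2 * l * κ * (m + 1)) / (m + 1 + 2 * l * m + 2 * κ) with hκ'_def
    have hκ' : -1 < 2 * κ' := by
      have hprod := helmert_exact_product (l := l) (κ := κ) (ne_of_gt (by positivity : 0 < m + 1)) hD.ne'
      have h1 : 0 < 1 + 2 * ((l * m + κ) / (m + 1)) := by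
        have : 1 + 2 * ((l * m + κ) / (m + 1)) = (m + 1 + 2 * l * m + 2 * κ) / (m + 1) := by
          field_simp
          ring
        rw [this]; positivity
      have h2 : 0 < (1 + 2 * l) * (1 + 2 * κ) := mul_pos (by linarith) (by linarith)
      rw [← hprod] at h2
      have h3 : 0 < 1 + 2 * κ' := by
        rw [hκ'_def]
        exact pos_of_mul_pos_right (by linarith [h2]) h1.le
      linarith
    -- the integrand at level `n + 2` and its measurability
    set F : (Fin (n + 1 + 1) → V3) → ℝ≥0∞ := fun v => ENNReal.ofReal (Real.exp
        (-(l / θ) * ((∑ i, ‖v i‖ ^ 2) - ‖∑ i, v i‖ ^ 2 / (((n + 1 : ℕ) : ℝ) + 1)) -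
          κ / (θ * (((n + 1 : ℕ) : ℝ) + 1)) * ‖(∑ i, v i) - (((n + 1 : ℕ) : ℝ) + 1) • u‖ ^ 2))
      with hF_def
    have hFm : Measurable F := by
      refine ENNReal.measurable_ofReal.comp (Continuous.measurable ?_)
      fun_prop
    -- the Helmert split of the integrand
    have hsplit : ∀ (x : V3) (y : Fin (n + 1) → V3), F (Fin.cons x y) =
        ENNReal.ofReal (Real.exp (-A * ‖x‖ ^ 2 +
          inner ℝ ((2 / (θ * (m + 1))) • ((l - κ) • (∑ i, y i) + (κ * (m + 1)) • u)) x +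
          (-(l / θ) * ((∑ i, ‖y i‖ ^ 2) - ‖∑ i, y i‖ ^ 2 / (m + 1)) -
            κ / (θ * (m + 1)) * ‖(∑ i, y i) - (m + 1) • u‖ ^ 2))) := by
      intro x y
      rw [hF_def]
      dsimp only
      have e1 := Fin.sum_univ_succ (f := fun i : Fin (n + 1 + 1) => ‖(Fin.cons x y : Fin (n + 1 + 1) → V3) i‖ ^ 2)
      simp only [Fin.cons_zero, Fin.cons_succ] at e1
      have e2 : (∑ i, (Fin.cons x y : Fin (n + 1 + 1) → V3) i) = x + ∑ i, y i := Fin.sum_cons x y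
      rw [hm1, e1, e2, helmert_exact_split hθ.ne' (ne_of_gt (by positivity : 0 < m + 1)) x _ u, hA_def]
    -- integrate the new particle first
    have hinner : ∀ y : Fin (n + 1) → V3, ∫⁻ x, F (Fin.cons x y) ∂(gaussMeasure u θ) =
        ENNReal.ofReal ((1 + 2 * A * θ) ^ (-(3 : ℝ) / 2)) *
          ENNReal.ofReal (Real.exp (-(l / θ) * ((∑ i, ‖y i‖ ^ 2) - ‖∑ i, y i‖ ^ 2 / m) -
            κ' / (θ * m) * ‖(∑ i, y i) - m • u‖ ^ 2)) := by
      intro y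
      simp_rw [hsplit]
      rw [lintegral_exp_quad_gaussMeasure u _ _ hθ hA,
        ← ENNReal.ofReal_mul (Real.rpow_nonneg (by linarith) _)]
      congr 2
      have h := helmert_exact_close (S₂ := ∑ i, ‖y i‖ ^ 2) hθ.ne' hm0.ne'
        (ne_of_gt (by positivity : 0 < m + 1)) hD.ne' (∑ i, y i) u
      dsimp only at h
      rw [← hA_def, ← hκ'_def] at h
      exact congrArg Real.exp h
    calc ∫⁻ v, F v ∂(Measure.pi fun _ : Fin (n + 1 + 1) => gaussMeasure u θ)
        = ∫⁻ y, ∫⁻ x, F (Fin.cons x y) ∂(gaussMeasure u θ)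
            ∂(Measure.pi fun _ : Fin (n + 1) => gaussMeasure u θ) := lintegral_pi_succ_cons hFm
      _ = ENNReal.ofReal ((1 + 2 * A * θ) ^ (-(3 : ℝ) / 2)) *
            ENNReal.ofReal ((1 + 2 * l) ^ (-(3 : ℝ) / 2 * n) * (1 + 2 * κ') ^ (-(3 : ℝ) / 2)) := by
          simp_rw [hinner]
          rw [lintegral_const_mul' _ _ ENNReal.ofReal_ne_top, ih κ' hκ']
      _ = ENNReal.ofReal ((1 + 2 * l) ^ (-(3 : ℝ) / 2 * ((n + 1 : ℕ) : ℝ)) *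
            (1 + 2 * κ) ^ (-(3 : ℝ) / 2)) := by
          rw [← ENNReal.ofReal_mul (Real.rpow_nonneg (by linarith) _)]
          congr 1
          have hl0 : 0 < 1 + 2 * l := by linarith
          have hκ0 : 0 ≤ 1 + 2 * κ := by linarith
          have hκ'0 : 0 ≤ 1 + 2 * κ' := by linarith
          have hA0 : 0 ≤ 1 + 2 * A * θ := by linarith
          have hprod : (1 + 2 * A * θ) * (1 + 2 * κ') = (1 + 2 * l) * (1 + 2 * κ) := by
            rw [hAθ, hκ'_def]
            have h := helmert_exact_product (l := l) (κ := κ)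
              (ne_of_gt (by positivity : 0 < m + 1)) hD.ne'
            rw [← h]
            congr 1
            field_simp
            ring
          calc (1 + 2 * A * θ) ^ (-(3 : ℝ) / 2) *
                ((1 + 2 * l) ^ (-(3 : ℝ) / 2 * n) * (1 + 2 * κ') ^ (-(3 : ℝ) / 2))
              = (1 + 2 * l) ^ (-(3 : ℝ) / 2 * n) *
                  ((1 + 2 * A * θ) * (1 + 2 * κ')) ^ (-(3 : ℝ) / 2) := by
                rw [Real.mul_rpow hA0 hκ'0]; ring
            _ = (1 + 2 * l) ^ (-(3 : ℝ) / 2 * n) *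
                  ((1 + 2 * l) ^ (-(3 : ℝ) / 2) * (1 + 2 * κ) ^ (-(3 : ℝ) / 2)) := by
                rw [hprod, Real.mul_rpow hl0.le hκ0]
            _ = (1 + 2 * l) ^ (-(3 : ℝ) / 2 * ((n + 1 : ℕ) : ℝ)) * (1 + 2 * κ) ^ (-(3 : ℝ) / 2) := by
                rw [← mul_assoc, ← Real.rpow_add hl0]
                congr 2
                push_cast
                ring

/-- **`stub_blockMGF_cochran`** (registered sub-goal of `stub_blockMGF`): Cochran's theorem for the
block velocity statistics of the homogeneous local Gibbs law, as an exact joint Laplace transform and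
without rotation invariance — for `n + 1` i.i.d. `N(u, θ id)` velocities (unit weights: box blocks),
the sum of squares about the mean `SS = 3(n+1)θ̄` (block temperature `θ̄`) and the drift
`(n+1)‖v̄ − u‖²` satisfy `E exp(−(λ/θ)SS − (κ/θ)(n+1)‖v̄ − u‖²) = (1+2λ)^{−(3/2)n}(1+2κ)^{−3/2}` for all
`2λ > −1`, `2κ > −1` (cold and hot blocks, and the drift term of the kinetic Bregman divergence,
jointly, with the sharp constants). [folklore] -/
theorem stub_blockMGF_cochran : ∀ (n : ℕ) (u : V3) (θ : ℝ), 0 < θ → ∀ l κ : ℝ, -1 < 2 * l → -1 < 2 * κ → ∫⁻ v, ENNReal.ofReal (Real.exp (-(l / θ) * ((∑ i, ‖v i‖ ^ 2) - ‖∑ i, v i‖ ^ 2 / ((n : ℝ) + 1)) - κ / (θ * ((n : ℝ) + 1)) * ‖(∑ i, v i) - ((n : ℝ) + 1) • u‖ ^ 2)) ∂(Measure.pi fun _ : Fin (n + 1) => gaussMeasure u θ) = ENNReal.ofReal ((1 + 2 * l) ^ (-(3 : ℝ) / 2 * n) * (1 + 2 * κ) ^ (-(3 : ℝ) / 2)) 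:=
  fun n u _ hθ _ κ hl hκ => lintegral_exp_cochran u hθ hl n κ hκ

end Barycentric

end Summit.AtomisticToContinuum.HydrodynamicLimit.Theorems.MacroClosureLine

end
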